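import Summits.QuantumFields.YangMills.Theorems.ColdStartUniversalityLatticeLangevinRiemannContractionAllLipschitz
import Summits.QuantumFields.YangMills.Theorems.ColdStartUniversalityLatticeLangevinExpMixing
import Literature.Probability.Process.HarrisTheorem
import HarnessLib

/-!
# Cold-start mixing in `W₁` for EVERY `ρ_L`-Lipschitz observable of the `SU(2)` lattice Langevin dynamics, with the VOLUME-UNIFORM rate
# `1 − 12|β'|`: `|P_t F(Q) − μ_(β')(F)| ≤ e^(−(1−12|β'|)t)·Lip_(ρ_L)(F)·∫ρ_L(Q,·)dμ_(β') ≤ e^(−(1−12|β'|)t)·Lip_(ρ_L)(F)·√2·π·√#E`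

Seat `ym-line-csu-p1` (g41), route `ColdStartUniversality` of `Summits/QuantumFields/YangMills`, helper file G55 (`--supports stmt-QuantumFields-24809`).
G54 (`…RiemannContractionAllLipschitz`) gave Shen–Zhu–Zhu's (4.5) in `W₁` form for all Lipschitz observables.  Integrating the second start against the
invariant Wilson–Gibbs law `μ_(β')` (tree: `wilsonMeasureLangevinInvariant_su2`, `wilson_invariant_of_fact`) turns it into mixing FROM EVERY
DETERMINISTIC (cold) START, for every `ρ_L`-Lipschitz observable, with a rate independent of the volume and a prefactor `Lip·(mean distance to Q)`:

* ★★★ `wilson_coldStart_W1_mixing_allLipschitz` — `|∫F dκ_t(Q) − ∫F dμ_(β')| ≤ e^(−(1−12|β'|)t)·L_F·∫ ρ_L(Q,Q') dμ_(β')(Q')`;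
* ★★ `wilson_coldStart_W1_mixing_allLipschitz_diam` — `… ≤ e^(−(1−12|β'|)t)·L_F·(√2·π·√#E)` (`diam_(ρ_L) SU(2)^E ≤ √2·π·√#E`, G41);
* ★★ `wilson_W1_mixing_allLipschitz_of_initialLaw` — the same from every initial LAW `ν`: `|∫F d(κ_t ∘ₘ ν) − ∫F dμ_(β')| ≤ e^(−(1−12|β'|)t)·L_F·√2·π·√#E`.

Compare the tree's `exp_mixing_transitionKernel` (every `β'`, bounded measurable observables, but constants `C, c` depending on `L` through Doeblin) and
`coldStart_measurable_sq_sub_le_exp_uniform` (uniform rate in `L²(μ)` after a burn-in with an `L`-dependent density constant): here the rate AND the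
shape of the prefactor are explicit and uniform; only `diam_(ρ_L) = O(√#E)` grows with the volume, as it must for a cold start.
THEOREMS ONLY, no definition, no sorry.  HONEST FRAMING: fixed cut-off, high-temperature window `|β'| < 1/12`; nothing `K`-uniform along the route's
scaling; `UniformColdStartMixing` (24809, ASIDE) is not restated and not proved; no crux, rung or summit statement is proved; the Yang–Mills mass gap
is NOT proved.
-/

set_option autoImplicit false

noncomputable section

namespace Summit.QuantumFields.YangMills.Theorems.ColdStartUniversality

open MeasureTheory ProbabilityTheory Matrix Complex Finset Filter Topology Set
open scoped BigOperators Real NNReal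
open Literature.MathematicalPhysics.QuantumFieldTheory
open Literature.MathematicalPhysics.QuantumLattice (fundamentalRep fundamentalLatticeRep continuous_fundamentalRep fundamentalRep_apply fundamentalLatticeRep_N)

/-- ★★★ **Cold-start `W₁` mixing, every `ρ_L`-Lipschitz observable, volume-uniform rate.**  For `|β'| < 1/12`, every `L`, every realising kernel
family `κ`, every deterministic start `Q`, every `t ≥ 0` and every `F : SU(2)^E → ℝ` with `|F(Q') − F(Q)| ≤ L_F·ρ_L(Q,Q')`:
`|∫F dκ_t(Q) − ∫F dμ_(β')| ≤ e^(−(1−12|β'|)t)·L_F·∫ ρ_L(Q,Q') dμ_(β')(Q')` (invariance of `μ_(β')` + G54). [cite: ShenZhuZhu2022, Theorem 4.2 (4.5)] -/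
theorem wilson_coldStart_W1_mixing_allLipschitz (L : ℕ) [NeZero L]
    {F : GaugeConfig 3 L (Matrix.specialUnitaryGroup (Fin 2) ℂ) → ℝ} {Lf : ℝ} (hLf : 0 ≤ Lf)
    (hlip : ∀ Q Q', |F Q' - F Q| ≤ Lf * Real.sqrt (torusRiemannDistSq (fundamentalLatticeRep 2) Q Q'))
    (Q : GaugeConfig 3 L (Matrix.specialUnitaryGroup (Fin 2) ℂ)) (t : ℝ≥0) (β' : ℝ) (hβ : |β'| < 1 / 12)
    (κ : ℝ≥0 → Kernel (GaugeConfig 3 L (Matrix.specialUnitaryGroup (Fin 2) ℂ))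
      (GaugeConfig 3 L (Matrix.specialUnitaryGroup (Fin 2) ℂ))) [∀ t, IsMarkovKernel (κ t)]
    (hreal : ∀ (t : ℝ≥0) (x : GaugeConfig 3 L (Matrix.specialUnitaryGroup (Fin 2) ℂ))
        (Ω : Type) [MeasurableSpace Ω] (P : Measure Ω) [IsProbabilityMeasure P]
        (W : ℝ≥0 → Ω → (Edge 3 L × NoiseIdx 2 → ℝ)) (hW : IsFlatBrownian W P)
        (U : ℝ≥0 → Ω → GaugeConfig 3 L (Matrix.specialUnitaryGroup (Fin 2) ℂ)),
        (∀ ω, U 0 ω = x) →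
        (latticeLangevinDynamics (fundamentalLatticeRep 2) β').IsSolution (fundamentalRep (Fin 2))
          hW.natFiltration P W U →
        κ t x = P.map (U t))
    :
    |∫ y, F y ∂(κ t Q) - ∫ y, F y ∂(wilsonMeasure (d := 3) (L := L) (fundamentalRep (Fin 2)) β')| ≤
      Real.exp (-((1 - 12 * |β'|) * (t : ℝ))) * Lf *
        ∫ Q', Real.sqrt (torusRiemannDistSq (fundamentalLatticeRep 2) Q Q') ∂(wilsonMeasure (d := 3) (L := L) (fundamentalRep (Fin 2)) β') := by
  haveI : IsProbabilityMeasure (wilsonMeasure (d := 3) (L := L) (fundamentalRep (Fin 2)) β') :=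
    isProbabilityMeasure_wilsonMeasure (d := 3) (L := L) (fundamentalRep (Fin 2)) (continuous_fundamentalRep (Fin 2)) β'
  haveI := borelSpace_config L
  have hFc : Continuous F := continuous_of_riemannLipschitz hlip
  have hκF : Continuous fun x => ∫ y, F y ∂(κ t x) := continuous_integral_transitionKernel L β' κ hreal t hFc
  have hinv : Kernel.Invariant (κ t) (wilsonMeasure (d := 3) (L := L) (fundamentalRep (Fin 2)) β') :=
    wilson_invariant_of_fact L β' (wilsonMeasureLangevinInvariant_su2 L β') κ hreal t
  have hFiμ : Integrable F (wilsonMeasure (d := 3) (L := L) (fundamentalRep (Fin 2)) β') := hFc.integrable_of_hasCompactSupport (HasCompactSupport.of_compactSpace F)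
  have hκFi : Integrable (fun x => ∫ y, F y ∂(κ t x)) (wilsonMeasure (d := 3) (L := L) (fundamentalRep (Fin 2)) β') :=
    hκF.integrable_of_hasCompactSupport (HasCompactSupport.of_compactSpace _)
  -- invariance: `∫F dμ = ∫ κ_t F dμ`
  have hμF : ∫ y, F y ∂(wilsonMeasure (d := 3) (L := L) (fundamentalRep (Fin 2)) β') = ∫ Q', (∫ y, F y ∂(κ t Q')) ∂(wilsonMeasure (d := 3) (L := L) (fundamentalRep (Fin 2)) β') := by
    have hFi' : Integrable F (κ t ∘ₘ (wilsonMeasure (d := 3) (L := L) (fundamentalRep (Fin 2)) β')) := by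
      rw [hinv.def]; exact hFiμ
    have h1 := Literature.Probability.Process.Harris.integral_comp_measure (κ t) (wilsonMeasure (d := 3) (L := L) (fundamentalRep (Fin 2)) β') hFi'
    rw [hinv.def] at h1
    exact h1
  have hdiff : (∫ y, F y ∂(κ t Q)) - ∫ y, F y ∂(wilsonMeasure (d := 3) (L := L) (fundamentalRep (Fin 2)) β') =
      ∫ Q', ((∫ y, F y ∂(κ t Q)) - ∫ y, F y ∂(κ t Q')) ∂(wilsonMeasure (d := 3) (L := L) (fundamentalRep (Fin 2)) β') := by
    rw [hμF, integral_sub (integrable_const _) hκFi, integral_const, probReal_univ, one_smul]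
  rw [hdiff]
  have hpt : ∀ Q', |(∫ y, F y ∂(κ t Q)) - ∫ y, F y ∂(κ t Q')| ≤
      Real.exp (-((1 - 12 * |β'|) * (t : ℝ))) * Lf * Real.sqrt (torusRiemannDistSq (fundamentalLatticeRep 2) Q Q') := fun Q' =>
    wilson_riemannLipschitz_contraction_allLipschitz L hLf hlip Q Q' t β' hβ κ hreal
  have hρc : Continuous fun Q' : GaugeConfig 3 L (Matrix.specialUnitaryGroup (Fin 2) ℂ) => Real.sqrt (torusRiemannDistSq (fundamentalLatticeRep 2) Q Q') :=
    Real.continuous_sqrt.comp (continuous_torusRiemannDistSq_two_right Q)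
  have hρi : Integrable (fun Q' => Real.sqrt (torusRiemannDistSq (fundamentalLatticeRep 2) Q Q')) (wilsonMeasure (d := 3) (L := L) (fundamentalRep (Fin 2)) β') :=
    hρc.integrable_of_hasCompactSupport (HasCompactSupport.of_compactSpace _)
  calc |∫ Q', ((∫ y, F y ∂(κ t Q)) - ∫ y, F y ∂(κ t Q')) ∂(wilsonMeasure (d := 3) (L := L) (fundamentalRep (Fin 2)) β')|
      ≤ ∫ Q', |(∫ y, F y ∂(κ t Q)) - ∫ y, F y ∂(κ t Q')| ∂(wilsonMeasure (d := 3) (L := L) (fundamentalRep (Fin 2)) β') := abs_integral_le_integral_abs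
    _ ≤ ∫ Q', Real.exp (-((1 - 12 * |β'|) * (t : ℝ))) * Lf * Real.sqrt (torusRiemannDistSq (fundamentalLatticeRep 2) Q Q') ∂(wilsonMeasure (d := 3) (L := L) (fundamentalRep (Fin 2)) β') :=
        integral_mono_of_nonneg (ae_of_all _ fun _ => abs_nonneg _) (hρi.const_mul _) (ae_of_all _ hpt)
    _ = Real.exp (-((1 - 12 * |β'|) * (t : ℝ))) * Lf * ∫ Q', Real.sqrt (torusRiemannDistSq (fundamentalLatticeRep 2) Q Q') ∂(wilsonMeasure (d := 3) (L := L) (fundamentalRep (Fin 2)) β') :=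
        integral_const_mul _ _

/-- ★★ **Cold-start `W₁` mixing with the diameter bound**: `|∫F dκ_t(Q) − ∫F dμ_(β')| ≤ e^(−(1−12|β'|)t)·L_F·(√2·π·√#E)` for every deterministic
start `Q` (`ρ_L ≤ √(2π²#E)`, G41). [cite: ShenZhuZhu2022, Theorem 4.2 (4.5)] -/
theorem wilson_coldStart_W1_mixing_allLipschitz_diam (L : ℕ) [NeZero L]
    {F : GaugeConfig 3 L (Matrix.specialUnitaryGroup (Fin 2) ℂ) → ℝ} {Lf : ℝ} (hLf : 0 ≤ Lf)
    (hlip : ∀ Q Q', |F Q' - F Q| ≤ Lf * Real.sqrt (torusRiemannDistSq (fundamentalLatticeRep 2) Q Q'))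
    (Q : GaugeConfig 3 L (Matrix.specialUnitaryGroup (Fin 2) ℂ)) (t : ℝ≥0) (β' : ℝ) (hβ : |β'| < 1 / 12)
    (κ : ℝ≥0 → Kernel (GaugeConfig 3 L (Matrix.specialUnitaryGroup (Fin 2) ℂ))
      (GaugeConfig 3 L (Matrix.specialUnitaryGroup (Fin 2) ℂ))) [∀ t, IsMarkovKernel (κ t)]
    (hreal : ∀ (t : ℝ≥0) (x : GaugeConfig 3 L (Matrix.specialUnitaryGroup (Fin 2) ℂ))
        (Ω : Type) [MeasurableSpace Ω] (P : Measure Ω) [IsProbabilityMeasure P]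
        (W : ℝ≥0 → Ω → (Edge 3 L × NoiseIdx 2 → ℝ)) (hW : IsFlatBrownian W P)
        (U : ℝ≥0 → Ω → GaugeConfig 3 L (Matrix.specialUnitaryGroup (Fin 2) ℂ)),
        (∀ ω, U 0 ω = x) →
        (latticeLangevinDynamics (fundamentalLatticeRep 2) β').IsSolution (fundamentalRep (Fin 2))
          hW.natFiltration P W U →
        κ t x = P.map (U t))
    :
    |∫ y, F y ∂(κ t Q) - ∫ y, F y ∂(wilsonMeasure (d := 3) (L := L) (fundamentalRep (Fin 2)) β')| ≤
      Real.exp (-((1 - 12 * |β'|) * (t : ℝ))) * Lf * (Real.sqrt 2 * Real.pi * Real.sqrt (Fintype.card (Edge 3 L))) := by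
  haveI : IsProbabilityMeasure (wilsonMeasure (d := 3) (L := L) (fundamentalRep (Fin 2)) β') :=
    isProbabilityMeasure_wilsonMeasure (d := 3) (L := L) (fundamentalRep (Fin 2)) (continuous_fundamentalRep (Fin 2)) β'
  haveI := borelSpace_config L
  have h := wilson_coldStart_W1_mixing_allLipschitz L hLf hlip Q t β' hβ κ hreal
  have hdiam : ∀ Q', Real.sqrt (torusRiemannDistSq (fundamentalLatticeRep 2) Q Q') ≤ Real.sqrt 2 * Real.pi * Real.sqrt (Fintype.card (Edge 3 L)) := by
    intro Q'
    calc Real.sqrt (torusRiemannDistSq (fundamentalLatticeRep 2) Q Q') ≤ Real.sqrt (2 * Real.pi ^ 2 * Fintype.card (Edge 3 L)) :=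
          Real.sqrt_le_sqrt (torusRiemannDistSq_two_le_card Q Q')
      _ = Real.sqrt 2 * Real.pi * Real.sqrt (Fintype.card (Edge 3 L)) := by
          rw [Real.sqrt_mul (by positivity), Real.sqrt_mul (by norm_num), Real.sqrt_sq Real.pi_pos.le]
  have hρc : Continuous fun Q' : GaugeConfig 3 L (Matrix.specialUnitaryGroup (Fin 2) ℂ) => Real.sqrt (torusRiemannDistSq (fundamentalLatticeRep 2) Q Q') :=
    Real.continuous_sqrt.comp (continuous_torusRiemannDistSq_two_right Q)
  have hρi : Integrable (fun Q' => Real.sqrt (torusRiemannDistSq (fundamentalLatticeRep 2) Q Q')) (wilsonMeasure (d := 3) (L := L) (fundamentalRep (Fin 2)) β') :=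
    hρc.integrable_of_hasCompactSupport (HasCompactSupport.of_compactSpace _)
  have hint : ∫ Q', Real.sqrt (torusRiemannDistSq (fundamentalLatticeRep 2) Q Q') ∂(wilsonMeasure (d := 3) (L := L) (fundamentalRep (Fin 2)) β') ≤
      Real.sqrt 2 * Real.pi * Real.sqrt (Fintype.card (Edge 3 L)) := by
    calc ∫ Q', Real.sqrt (torusRiemannDistSq (fundamentalLatticeRep 2) Q Q') ∂(wilsonMeasure (d := 3) (L := L) (fundamentalRep (Fin 2)) β')
        ≤ ∫ _Q', Real.sqrt 2 * Real.pi * Real.sqrt (Fintype.card (Edge 3 L)) ∂(wilsonMeasure (d := 3) (L := L) (fundamentalRep (Fin 2)) β') :=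
          integral_mono hρi (integrable_const _) hdiam
      _ = Real.sqrt 2 * Real.pi * Real.sqrt (Fintype.card (Edge 3 L)) := by rw [integral_const, probReal_univ, one_smul]
  exact h.trans (mul_le_mul_of_nonneg_left hint (mul_nonneg (Real.exp_pos _).le hLf))

/-- ★★ **`W₁` mixing from every initial law**: for a probability measure `ν` of starts, `|∫F d(κ_t ∘ₘ ν) − ∫F dμ_(β')| ≤ e^(−(1−12|β'|)t)·L_F·√2·π·√#E`
for every `ρ_L`-Lipschitz `F`, `|β'| < 1/12`, uniformly in `L`. [cite: ShenZhuZhu2022, Theorem 4.2 (4.5)] -/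
theorem wilson_W1_mixing_allLipschitz_of_initialLaw (L : ℕ) [NeZero L]
    {F : GaugeConfig 3 L (Matrix.specialUnitaryGroup (Fin 2) ℂ) → ℝ} {Lf : ℝ} (hLf : 0 ≤ Lf)
    (hlip : ∀ Q Q', |F Q' - F Q| ≤ Lf * Real.sqrt (torusRiemannDistSq (fundamentalLatticeRep 2) Q Q'))
    (ν : Measure (GaugeConfig 3 L (Matrix.specialUnitaryGroup (Fin 2) ℂ))) [IsProbabilityMeasure ν] (t : ℝ≥0) (β' : ℝ) (hβ : |β'| < 1 / 12)
    (κ : ℝ≥0 → Kernel (GaugeConfig 3 L (Matrix.specialUnitaryGroup (Fin 2) ℂ))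
      (GaugeConfig 3 L (Matrix.specialUnitaryGroup (Fin 2) ℂ))) [∀ t, IsMarkovKernel (κ t)]
    (hreal : ∀ (t : ℝ≥0) (x : GaugeConfig 3 L (Matrix.specialUnitaryGroup (Fin 2) ℂ))
        (Ω : Type) [MeasurableSpace Ω] (P : Measure Ω) [IsProbabilityMeasure P]
        (W : ℝ≥0 → Ω → (Edge 3 L × NoiseIdx 2 → ℝ)) (hW : IsFlatBrownian W P)
        (U : ℝ≥0 → Ω → GaugeConfig 3 L (Matrix.specialUnitaryGroup (Fin 2) ℂ)),
        (∀ ω, U 0 ω = x) →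
        (latticeLangevinDynamics (fundamentalLatticeRep 2) β').IsSolution (fundamentalRep (Fin 2))
          hW.natFiltration P W U →
        κ t x = P.map (U t))
    :
    |∫ y, F y ∂(κ t ∘ₘ ν) - ∫ y, F y ∂(wilsonMeasure (d := 3) (L := L) (fundamentalRep (Fin 2)) β')| ≤
      Real.exp (-((1 - 12 * |β'|) * (t : ℝ))) * Lf * (Real.sqrt 2 * Real.pi * Real.sqrt (Fintype.card (Edge 3 L))) := by
  haveI := borelSpace_config L
  haveI : IsProbabilityMeasure (κ t ∘ₘ ν) := by
    constructor
    rw [Measure.bind_apply MeasurableSet.univ (κ t).measurable.aemeasurable]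
    simp
  have hFc : Continuous F := continuous_of_riemannLipschitz hlip
  have hκF : Continuous fun x => ∫ y, F y ∂(κ t x) := continuous_integral_transitionKernel L β' κ hreal t hFc
  have hFi : Integrable F (κ t ∘ₘ ν) := hFc.integrable_of_hasCompactSupport (HasCompactSupport.of_compactSpace F)
  have hκFi : Integrable (fun x => ∫ y, F y ∂(κ t x)) ν := hκF.integrable_of_hasCompactSupport (HasCompactSupport.of_compactSpace _)
  set m : ℝ := ∫ y, F y ∂(wilsonMeasure (d := 3) (L := L) (fundamentalRep (Fin 2)) β') with hm
  set B : ℝ := Real.exp (-((1 - 12 * |β'|) * (t : ℝ))) * Lf * (Real.sqrt 2 * Real.pi * Real.sqrt (Fintype.card (Edge 3 L))) with hB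
  rw [Literature.Probability.Process.Harris.integral_comp_measure (κ t) ν hFi]
  have hsub : (∫ z, (∫ y, F y ∂(κ t z)) ∂ν) - m = ∫ z, ((∫ y, F y ∂(κ t z)) - m) ∂ν := by
    rw [integral_sub hκFi (integrable_const m), integral_const, probReal_univ, one_smul]
  rw [hsub]
  have hpt : ∀ z, |(∫ y, F y ∂(κ t z)) - m| ≤ B := fun z =>
    wilson_coldStart_W1_mixing_allLipschitz_diam L hLf hlip z t β' hβ κ hreal
  calc |∫ z, ((∫ y, F y ∂(κ t z)) - m) ∂ν| ≤ ∫ z, |(∫ y, F y ∂(κ t z)) - m| ∂ν := abs_integral_le_integral_abs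
    _ ≤ ∫ _z, B ∂ν := integral_mono (hκFi.sub (integrable_const m)).abs (integrable_const _) hpt
    _ = B := by rw [integral_const, probReal_univ, one_smul]

end Summit.QuantumFields.YangMills.Theorems.ColdStartUniversality

end
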